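import Summits.NavierStokesRegularity.NavierStokesRegularity.Theorems.ExtremiserTransienceNearExtremalTransienceExtremiserLiouvilleConstantSpeedCalculus
import Summits.NavierStokesRegularity.NavierStokesRegularity.Theorems.ExtremiserTransienceKStarAttainedHalfSpaceVariation
import Literature.Analysis.FluidPDE.LagrangianTimeDerivativeTools
import HarnessLib

/-!
# Crux `ExtremiserTransience.NearExtremalTransience` (stmt-NavierStokesRegularity-21883), line `extremiser_liouville`,
# stub K1b — CONSTANT-SPEED STRETCHING STRUCTURE: only the vorticity component orthogonal to `v` is stretched

`--supports stmt-NavierStokesRegularity-21883` (helper).  Author: prover seat `ns-el-k1b` (g3).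

First brick of the direct route (N5' of `Lines/extremiser_liouville_k1b_multiplier.md`: «constant-speed efficiency gap» — K1b would
follow outright from `|S| ≤ κ M√Z√W` with `κ ≤ 13/200 < κ⋆` on CONSTANT-SPEED fields).  For a differentiable field `v` with
`‖v‖ ≡ M` (so `range Dv ⊥ v`, `…ConstantSpeedCalculus.inner_fderiv_apply_eq_zero_of_norm_eq`):

* `fderiv_apply_self_eq_cross_curl` : **`Dv·v = (curl v) × v`** (Lamb's identity with `∇‖v‖² = 0`; from the tree's
  `inner_cross_curl`);
* `inner_curl_stretching_eq_perp` : **`⟪ω, Dv ω⟫ = ⟪ω_⊥, Dv ω_⊥⟫`** with `ω = curl v`, `ω_⊥ = ω − (⟪ω,v⟫/M²)·v` the component of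
  the vorticity orthogonal to `v`: the TWIST `⟪ω, v⟫` does not stretch;
* `norm_sq_curl_perp` : `‖ω_⊥‖² = ‖ω‖² − ⟪ω,v⟫²/M²`;
* `abs_curl_stretching_le_perp` : **`|⟪ω, Dv ω⟫| ≤ ‖Dv‖·(‖ω‖² − ⟪ω,v⟫²/M²)`** pointwise;
* `Jst_eq_integral_perp` : `S(v) = ∫ ⟪ω_⊥, Dv ω_⊥⟫` for constant-speed fields (the stretching functional of the K1b residue object
  only sees `ω_⊥`, while `Z = ‖ω‖₂²`, `W = ‖∇ω‖₂²` see the twist too).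

WHAT THIS IS NOT: structure lemmas for HYPOTHETICAL constant-speed extremisers; K1b is NOT proved; nothing here proves NS
regularity. [folklore]
-/

noncomputable section

open Set Filter Topology MeasureTheory Metric Function
open scoped ENNReal NNReal Topology InnerProductSpace RealInnerProductSpace ContDiff
open Literature.Analysis.FluidPDE Literature.Analysis

namespace Summit.NavierStokesRegularity.NavierStokesRegularity.Theorems

-- the problem directory repeats the summit name (`NavierStokesRegularity/NavierStokesRegularity`)
set_option linter.dupNamespace false

namespace ExtremiserLiouville

open DepletionLadder.KStar DepletionLadder.KStar.HalfSpace

variable {v : E3 → E3} {M : ℝ}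

/-- `a × b ⟂ a`. [folklore] -/
theorem inner_cross_left_self_eq_zero (a b : E3) : ⟪cross a b, a⟫_ℝ = 0 := by
  simp only [cross, PiLp.inner_apply, cross_apply, RCLike.inner_apply, conj_trivial,
    Fin.sum_univ_three, Matrix.cons_val_zero, Matrix.cons_val_one, Matrix.cons_val_two,
    Matrix.head_cons, Matrix.tail_cons]
  ring

/-- `a × b ⟂ b`. [folklore] -/
theorem inner_cross_right_self_eq_zero (a b : E3) : ⟪cross a b, b⟫_ℝ = 0 := by
  simp only [cross, PiLp.inner_apply, cross_apply, RCLike.inner_apply, conj_trivial,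
    Fin.sum_univ_three, Matrix.cons_val_zero, Matrix.cons_val_one, Matrix.cons_val_two,
    Matrix.head_cons, Matrix.tail_cons]
  ring

/-- `⟪a × e, b⟫ = ⟪e, b × a⟫` (cyclic symmetry of the triple product). [folklore] -/
theorem inner_cross_left_eq_inner_cross_right (a e b : E3) : ⟪cross a e, b⟫_ℝ = ⟪e, cross b a⟫_ℝ := by
  simp only [cross, PiLp.inner_apply, cross_apply, RCLike.inner_apply, conj_trivial,
    Fin.sum_univ_three, Matrix.cons_val_zero, Matrix.cons_val_one, Matrix.cons_val_two,
    Matrix.head_cons, Matrix.tail_cons]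
  ring

/-- **`Dv·v = ω × v` for a constant-speed field** (Lamb's identity `(v·∇)v = ∇(‖v‖²/2) + ω × v` with `∇‖v‖² = 0`).
[folklore] -/
theorem fderiv_apply_self_eq_cross_curl (hv : Differentiable ℝ v) (hM : ∀ x, ‖v x‖ = M) (x : E3) :
    fderiv ℝ v x (v x) = cross (curl v x) (v x) := by
  refine ext_inner_left ℝ fun e => ?_
  -- `⟪v × e, curl v⟫ = ⟪e, Dv v⟫ − ⟪v, Dv e⟫ = ⟪e, Dv v⟫`
  have h := inner_cross_curl (v x) e v x
  rw [inner_fderiv_apply_eq_zero_of_norm_eq hv hM x e, sub_zero] at h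
  rw [← h, inner_cross_left_eq_inner_cross_right]

/-- **Only the orthogonal vorticity is stretched: `⟪ω, Dv ω⟫ = ⟪ω_⊥, Dv ω_⊥⟫`**, `ω_⊥ = ω − (⟪ω,v⟫/M²) v`, for a
constant-speed field (`range Dv ⊥ v` and `Dv v = ω × v ⊥ ω`). [folklore] -/
theorem inner_curl_stretching_eq_perp (hv : Differentiable ℝ v) (hM : ∀ x, ‖v x‖ = M) (x : E3) :
    ⟪curl v x, fderiv ℝ v x (curl v x)⟫_ℝ =
      ⟪curl v x - (⟪curl v x, v x⟫_ℝ / M ^ 2) • v x,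
        fderiv ℝ v x (curl v x - (⟪curl v x, v x⟫_ℝ / M ^ 2) • v x)⟫_ℝ := by
  have h0 : ∀ e, ⟪v x, fderiv ℝ v x e⟫_ℝ = 0 := fun e => inner_fderiv_apply_eq_zero_of_norm_eq hv hM x e
  have hself := fderiv_apply_self_eq_cross_curl hv hM x
  have hperp : ⟪curl v x, cross (curl v x) (v x)⟫_ℝ = 0 := by
    rw [real_inner_comm]; exact inner_cross_left_self_eq_zero _ _
  have hperp' : ⟪v x, cross (curl v x) (v x)⟫_ℝ = 0 := by
    rw [real_inner_comm]; exact inner_cross_right_self_eq_zero _ _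
  rw [map_sub, map_smul, hself, inner_sub_left, inner_sub_right, inner_sub_right, real_inner_smul_left,
    real_inner_smul_left, real_inner_smul_right, real_inner_smul_right, h0, hperp, hperp']
  ring

/-- `‖ω_⊥‖² = ‖ω‖² − ⟪ω,v⟫²/M²` for the orthogonal component `ω_⊥ = ω − (⟪ω,v⟫/M²) v` (`‖v‖ = M ≠ 0`). [folklore] -/
theorem norm_sq_curl_perp (hM : ∀ x, ‖v x‖ = M) (hM0 : M ≠ 0) (x : E3) :
    ‖curl v x - (⟪curl v x, v x⟫_ℝ / M ^ 2) • v x‖ ^ 2 = ‖curl v x‖ ^ 2 - ⟪curl v x, v x⟫_ℝ ^ 2 / M ^ 2 := by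
  rw [norm_sub_sq_real, norm_smul, mul_pow, Real.norm_eq_abs, sq_abs, hM x, inner_smul_right]
  field_simp
  ring

/-- **Pointwise bound: `|⟪ω, Dv ω⟫| ≤ ‖Dv‖ · (‖ω‖² − ⟪ω,v⟫²/M²)`** for a constant-speed field. [folklore] -/
theorem abs_curl_stretching_le_perp (hv : Differentiable ℝ v) (hM : ∀ x, ‖v x‖ = M) (hM0 : M ≠ 0) (x : E3) :
    |⟪curl v x, fderiv ℝ v x (curl v x)⟫_ℝ| ≤ ‖fderiv ℝ v x‖ * (‖curl v x‖ ^ 2 - ⟪curl v x, v x⟫_ℝ ^ 2 / M ^ 2) := by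
  rw [inner_curl_stretching_eq_perp hv hM x, ← norm_sq_curl_perp hM hM0 x]
  set u := curl v x - (⟪curl v x, v x⟫_ℝ / M ^ 2) • v x
  calc |⟪u, fderiv ℝ v x u⟫_ℝ| ≤ ‖u‖ * ‖fderiv ℝ v x u‖ := abs_real_inner_le_norm _ _
    _ ≤ ‖u‖ * (‖fderiv ℝ v x‖ * ‖u‖) := by gcongr; exact (fderiv ℝ v x).le_opNorm u
    _ = ‖fderiv ℝ v x‖ * ‖u‖ ^ 2 := by ring

/-- **`S(v) = ∫ ⟪ω_⊥, Dv ω_⊥⟫`** for a constant-speed field: the stretching functional of the residue object sees only the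
vorticity component orthogonal to `v`. [folklore] -/
theorem Jst_eq_integral_perp (hv : Differentiable ℝ v) (hM : ∀ x, ‖v x‖ = M) :
    Jst v = ∫ x, ⟪curl v x - (⟪curl v x, v x⟫_ℝ / M ^ 2) • v x,
      fderiv ℝ v x (curl v x - (⟪curl v x, v x⟫_ℝ / M ^ 2) • v x)⟫_ℝ := by
  unfold Jst
  exact integral_congr_ae (Eventually.of_forall fun x => inner_curl_stretching_eq_perp hv hM x)

end ExtremiserLiouville

end Summit.NavierStokesRegularity.NavierStokesRegularity.Theorems

end
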